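import Summits.KontsevichZagierPeriods.KontsevichZagierPeriods.Theses.HermiteRigidity
import Literature.NumberTheory.Transcendental.KZRelationsLE
import Literature.NumberTheory.Transcendental.KZLogCalculusProofs
import Literature.NumberTheory.Transcendental.KZSubcalculusInvariants
import Literature.NumberTheory.Transcendental.SemialgebraicMapsProofs
import Mathlib.Algebra.Polynomial.Derivative
import Mathlib.RingTheory.Algebraic.Basic

/-!
# drefute gen 3 — candidate proof of the lead-held stub `stub_reduction`
# (crux stmt-KontsevichZagierPeriods-10632 `RealEllipticSectorKernel`, line `oval-hermite-engine`,
# skeleton `Lines/oval-hermite-engine.lean` sha256 `be982d63baee…`)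

Refuter seat `refuter-drefute-stmt-KontsevichZagierPeriods-10632-g3-0`. This file is a CERTIFICATE
for the stub attack ("the stub is a theorem exactly as typed, hence neither false nor misstated"),
not a landing: the theorem `stub_reduction` below has the REGISTERED signature verbatim but lives in
the refuter namespace `…RealEllipticSectorKernel.DrefuteG3` so that no tree FQN is (re)declared.
The lead may copy it under its own namespace.

Contents:
* `hermite_decomposition` — Hermite's decomposition `ℚ[X] = ℚ[X]_{< deg g − 1} + D_g ℚ[X]`,
  `D_g Q = Q′g + Qg′/2` (degree induction; the proof is the ideator's
  `Cruxes/RealEllipticSectorKernel/SketchIdeator3.hermiteDecomposition_holds`, re-homed because crux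
  workfiles are not importable modules);
* `hermite_integer_normal_form` — for `deg g = 3`: `N·X^m = a + bX + D_g(Q_N)` with `N ≥ 1`,
  `a b ∈ ℤ`, `Q_N ∈ ℚ[X]`;
* bookkeeping in `KZ.FormalRep`: difference representations (`subRep`, one `integrandAddRel`
  move) and integer scaling (`of_constMul_int_sub_zsmul_mem_relations`, from the tree's
  `of_constMul_nat_sub_nsmul_mem_relations`);
* `stub_reduction` — verbatim signature, sorry-free: NO hypothesis on `u`, `v` or on the sign of
  `g` is needed (where `g ≤ 0` both sides of the pointwise identity are the same Lean junk `…/0`).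
-/

noncomputable section

open MeasureTheory Set Polynomial

namespace Summit.KontsevichZagierPeriods.HermiteRigidity.RealEllipticSectorKernel.DrefuteG3

open Literature.NumberTheory.Transcendental Literature.ModelTheory.ExponentialFields

/-! ## Hermite's decomposition (pure algebra over `ℚ[X]`) -/

/-- Coefficients of the twisted derivative of a monomial, `D_g (X^k) = k X^{k-1} g + X^k g′/2`.
[folklore] -/
theorem coeff_twistedDeriv_X_pow (g : ℚ[X]) (k j : ℕ) :
    (derivative (X ^ k) * g + X ^ k * derivative g * C (1 / 2 : ℚ)).coeff j
      = (k : ℚ) * (if k - 1 ≤ j then g.coeff (j - (k - 1)) else 0)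
        + (if k ≤ j then g.coeff (j - k + 1) * ((j - k : ℕ) + 1 : ℚ) else 0) * (1 / 2 : ℚ) := by
  rw [derivative_X_pow, mul_assoc, coeff_add, coeff_C_mul, coeff_X_pow_mul', coeff_mul_C,
    coeff_X_pow_mul', coeff_derivative]

/-- **Hermite's decomposition** `ℚ[X] = ℚ[X]_{<deg g − 1} + D_g ℚ[X]`, `D_g Q = Q′g + Qg′/2`, for
every `g` of positive degree (degree induction on the leading term: `D_g (X^k)` has degree
`k + deg g − 1` and leading coefficient `lc(g)·(k + deg g/2) ≠ 0`).
[cite: BostanLairezSalvy2013, §1 (Hermite reduction)] -/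
theorem hermite_decomposition (g : ℚ[X]) (hd : 0 < g.natDegree) (P : ℚ[X]) :
    ∃ (R Q : ℚ[X]), R.degree < ((g.natDegree - 1 : ℕ) : WithBot ℕ) ∧
      P = R + (derivative Q * g + Q * derivative g * C (1 / 2 : ℚ)) := by
  set d := g.natDegree with hd_def
  have hg0 : g ≠ 0 := by
    rintro rfl
    simp [hd_def] at hd
  have hlc : g.leadingCoeff ≠ 0 := leadingCoeff_ne_zero.mpr hg0
  have hlcd : g.coeff d = g.leadingCoeff := by rw [hd_def, coeff_natDegree]
  have hcast : ((d - 1 : ℕ) : ℚ) + 1 = d := by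
    rw [← Nat.cast_add_one, Nat.sub_add_cancel hd]
  -- the twisted derivation and its linearity
  set D : ℚ[X] → ℚ[X] := fun Q => derivative Q * g + Q * derivative g * C (1 / 2 : ℚ) with hD
  -- top coefficient and vanishing above, for `D (X^k)`
  have hcoeff_top : ∀ k : ℕ, (D (X ^ k)).coeff (k + d - 1) =
      g.leadingCoeff * ((k : ℚ) + (d : ℚ) / 2) := by
    intro k
    simp only [hD]
    rw [coeff_twistedDeriv_X_pow, if_pos (by omega), if_pos (by omega)]
    rcases Nat.eq_zero_or_pos k with rfl | hk
    · have e1 : 0 + d - 1 - 0 + 1 = d := by omega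
      have e2 : 0 + d - 1 - 0 = d - 1 := by omega
      rw [e1, e2, hcast, hlcd]
      push_cast
      ring
    · have e1 : k + d - 1 - (k - 1) = d := by omega
      have e2 : k + d - 1 - k = d - 1 := by omega
      rw [e1, e2, Nat.sub_add_cancel hd, hcast, hlcd]
      ring
  have hcoeff_gt : ∀ k j : ℕ, k + d - 1 < j → (D (X ^ k)).coeff j = 0 := by
    intro k j hj
    simp only [hD]
    rw [coeff_twistedDeriv_X_pow, if_pos (by omega), if_pos (by omega)]
    have h2 : g.coeff (j - k + 1) = 0 := coeff_eq_zero_of_natDegree_lt (by omega)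
    rcases Nat.eq_zero_or_pos k with rfl | hk
    · rw [h2]; simp
    · have h1 : g.coeff (j - (k - 1)) = 0 := coeff_eq_zero_of_natDegree_lt (by omega)
      rw [h1, h2]; simp
  -- induction on the degree of `P`
  induction P using WellFounded.induction Polynomial.degree_lt_wf with
  | _ P ih =>
    by_cases hP : P.degree < ((d - 1 : ℕ) : WithBot ℕ)
    · exact ⟨P, 0, hP, by simp⟩
    · have hP0 : P ≠ 0 := by
        rintro rfl
        exact hP (by rw [degree_zero]; exact WithBot.bot_lt_coe _)
      set N := P.natDegree with hN
      have hdegP : P.degree = N := degree_eq_natDegree hP0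
      have hNd : d - 1 ≤ N := by
        rw [not_lt, hdegP] at hP
        exact_mod_cast hP
      set k := N - (d - 1) with hk
      have hkN : k + d - 1 = N := by omega
      set c : ℚ := g.leadingCoeff * ((k : ℚ) + (d : ℚ) / 2) with hc
      have hkd : (0 : ℚ) < (k : ℚ) + (d : ℚ) / 2 := by positivity
      have hc0 : c ≠ 0 := mul_ne_zero hlc hkd.ne'
      set a : ℚ := P.leadingCoeff / c with ha
      set P₁ := P - C a * D (X ^ k) with hP₁
      have hdeg₁ : P₁.degree < P.degree := by
        rw [hdegP, degree_lt_iff_coeff_zero]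
        intro j hj
        rw [hP₁, coeff_sub, coeff_C_mul]
        rcases hj.lt_or_eq with hlt | heq
        · rw [hcoeff_gt k j (by omega), mul_zero, sub_zero]
          exact coeff_eq_zero_of_natDegree_lt hlt
        · rw [← heq, ← hkN, hcoeff_top k, hkN, ← hc, ha, div_mul_cancel₀ _ hc0, hN,
            coeff_natDegree, sub_self]
      obtain ⟨R, Q₁, hR, hPQ⟩ := ih P₁ hdeg₁
      refine ⟨R, Q₁ + C a * X ^ k, hR, ?_⟩
      have key : P = P₁ + C a * D (X ^ k) := by rw [hP₁]; ring
      rw [key, hPQ]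
      simp only [hD, derivative_add, derivative_mul, derivative_C, zero_mul, zero_add]
      ring

/-- A polynomial of degree `< 2` is `C (coeff 0) + C (coeff 1) · X`. [folklore] -/
theorem eq_C_add_C_mul_X_of_degree_lt_two {R : ℚ[X]} (hR : R.degree < (2 : ℕ)) :
    R = C (R.coeff 0) + C (R.coeff 1) * X := by
  rw [degree_lt_iff_coeff_zero] at hR
  ext j
  rcases j with _ | _ | j
  · simp
  · simp
  · rw [hR (j + 2) (by omega)]
    simp

/-- **Hermite's integer normal form for a cubic**: for `deg g = 3` and every `m` there are
`N ≥ 1`, `a b ∈ ℤ` and `Q ∈ ℚ[X]` with `N·X^m = a + b·X + (Q′g + Qg′/2)` in `ℚ[X]`.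
[cite: BostanLairezSalvy2013, §1 (Hermite reduction)] -/
theorem hermite_integer_normal_form (g : ℚ[X]) (hg : g.natDegree = 3) (m : ℕ) :
    ∃ (N : ℕ) (a b : ℤ) (Q : ℚ[X]), 0 < N ∧
      C (N : ℚ) * X ^ m = C (a : ℚ) + C (b : ℚ) * X +
        (derivative Q * g + Q * derivative g * C (1 / 2 : ℚ)) := by
  obtain ⟨R, Q, hR, hdec⟩ := hermite_decomposition g (by omega) (X ^ m)
  rw [hg] at hR
  have hR' : R = C (R.coeff 0) + C (R.coeff 1) * X :=
    eq_C_add_C_mul_X_of_degree_lt_two (by simpa using hR)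
  set α : ℚ := R.coeff 0 with hα
  set β : ℚ := R.coeff 1 with hβ
  refine ⟨α.den * β.den, α.num * β.den, β.num * α.den, C ((α.den * β.den : ℕ) : ℚ) * Q,
    Nat.mul_pos α.den_pos β.den_pos, ?_⟩
  have hαN : ((α.den * β.den : ℕ) : ℚ) * α = ((α.num * β.den : ℤ) : ℚ) := by
    push_cast
    have := Rat.mul_den_eq_num α
    linear_combination (β.den : ℚ) * this
  have hβN : ((α.den * β.den : ℕ) : ℚ) * β = ((β.num * α.den : ℤ) : ℚ) := by
    push_cast
    have := Rat.mul_den_eq_num β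
    linear_combination (α.den : ℚ) * this
  have key : C ((α.den * β.den : ℕ) : ℚ) * X ^ m =
      C ((α.den * β.den : ℕ) : ℚ) * R +
        C ((α.den * β.den : ℕ) : ℚ) * (derivative Q * g + Q * derivative g * C (1 / 2 : ℚ)) := by
    conv_lhs => rw [hdec]
    ring
  rw [key, hR', ← hαN, ← hβN]
  simp only [derivative_mul, derivative_C, zero_mul, zero_add, map_mul]
  ring

/-! ## Bookkeeping in `KZ.FormalRep` -/

section Bookkeeping

variable {n : ℕ}

/-- The difference representation `[σ, f₁ − f₂]` of two representations with the same domain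
(semialgebraic by `IsSemialgebraicFunOn.sub_holds`, integrable by `Integrable.sub`). [folklore] -/
def subRep (r₁ r₂ : KZ.IntegralRep n) (h : r₂.domain = r₁.domain) : KZ.IntegralRep n where
  domain := r₁.domain
  integrand := r₁.integrand - r₂.integrand
  isSemialgebraic_domain := r₁.isSemialgebraic_domain
  isSemialgebraicFunOn_integrand :=
    IsSemialgebraicFunOn.sub_holds r₁.isSemialgebraicFunOn_integrand
      (by rw [← h]; exact r₂.isSemialgebraicFunOn_integrand)
  integrableOn := r₁.integrableOn.sub (by rw [← h]; exact r₂.integrableOn)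

@[simp] theorem subRep_domain (r₁ r₂ : KZ.IntegralRep n) (h : r₂.domain = r₁.domain) :
    (subRep r₁ r₂ h).domain = r₁.domain := rfl

@[simp] theorem subRep_integrand (r₁ r₂ : KZ.IntegralRep n) (h : r₂.domain = r₁.domain) :
    (subRep r₁ r₂ h).integrand = r₁.integrand - r₂.integrand := rfl

/-- `[σ, f₁] − [σ, f₁ − f₂] − [σ, f₂]` is ONE integrand-additivity move (rule 1b). [folklore] -/
theorem of_sub_of_subRep_sub_of_mem_relations (r₁ r₂ : KZ.IntegralRep n)
    (h : r₂.domain = r₁.domain) :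
    KZ.of r₁ - KZ.of (subRep r₁ r₂ h) - KZ.of r₂ ∈ KZ.relations :=
  KZ.integrandAddRel_subset_relations
    ⟨n, r₁, subRep r₁ r₂ h, r₂, rfl, h, fun x _ => by simp, rfl⟩

/-- **Integer scaling is a derived rule**: `[σ, a·f] − a•[σ, f] ∈ relations` for every `a ∈ ℤ`
(the tree's `ℕ`-version `of_constMul_nat_sub_nsmul_mem_relations` plus `[σ,−kf] + [σ,kf] ∈
relations`). [folklore] -/
theorem of_constMul_int_sub_zsmul_mem_relations (r : KZ.IntegralRep n) (a : ℤ) :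
    KZ.of (r.constMul (a : ℝ) (isAlgebraic_int a)) - a • KZ.of r ∈ KZ.relations := by
  cases a with
  | ofNat k =>
    have h1 := r.of_constMul_nat_sub_nsmul_mem_relations k
    have h2 : KZ.of (r.constMul ((Int.ofNat k : ℤ) : ℝ) (isAlgebraic_int _)) -
        KZ.of (r.constMul (k : ℝ) (isAlgebraic_nat k)) ∈ KZ.relations :=
      KZ.of_sub_of_mem_relations_of_eqOn rfl fun x _ => by simp
    have e : KZ.of (r.constMul ((Int.ofNat k : ℤ) : ℝ) (isAlgebraic_int _)) - (Int.ofNat k) • KZ.of r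
        = (KZ.of (r.constMul ((Int.ofNat k : ℤ) : ℝ) (isAlgebraic_int _)) -
            KZ.of (r.constMul (k : ℝ) (isAlgebraic_nat k))) +
          (KZ.of (r.constMul (k : ℝ) (isAlgebraic_nat k)) - k • KZ.of r) := by
      rw [Int.ofNat_eq_natCast, natCast_zsmul]
      abel
    rw [e]
    exact add_mem h2 h1
  | negSucc k =>
    have h1 := r.of_constMul_nat_sub_nsmul_mem_relations (k + 1)
    have h2 : KZ.of (r.constMul ((k + 1 : ℕ) : ℝ) (isAlgebraic_nat (k + 1))) +
        KZ.of (r.constMul ((Int.negSucc k : ℤ) : ℝ) (isAlgebraic_int _)) ∈ KZ.relations :=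
      KZ.of_add_of_mem_relations_of_eqOn_neg rfl fun x _ => by
        simp only [KZ.IntegralRep.integrand_constMul, Int.cast_negSucc, Pi.neg_apply]
        ring
    have e : KZ.of (r.constMul ((Int.negSucc k : ℤ) : ℝ) (isAlgebraic_int _)) -
          (Int.negSucc k) • KZ.of r
        = (KZ.of (r.constMul ((k + 1 : ℕ) : ℝ) (isAlgebraic_nat (k + 1))) +
            KZ.of (r.constMul ((Int.negSucc k : ℤ) : ℝ) (isAlgebraic_int _))) -
          (KZ.of (r.constMul ((k + 1 : ℕ) : ℝ) (isAlgebraic_nat (k + 1))) - (k + 1) • KZ.of r) := by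
      rw [negSucc_zsmul]
      abel
    rw [e]
    exact sub_mem h2 h1

end Bookkeeping

/-! ## The stub -/

/-- **`stub_reduction`, verbatim signature (skeleton `be982d63baee…`), sorry-free.** Hermite
reduction of one moment generator to the INTEGER normal form: given the exact-form property of `g`
on `(u,v)` and representations `b₀ = [(u,v), 1/√g]`, `b₁ = [(u,v), x/√g]`, every
`r = [(u,v), xᵐ/√g]` satisfies `N•[r] ≡ a•[b₀] + b•[b₁]` modulo relations for some `N ≥ 1`,
`a b ∈ ℤ`. Proof: `N·xᵐ = a + b·x + D_g(Q)` (`hermite_integer_normal_form`); the representation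
`s = [(u,v), N·r − a·b₀ − b·b₁]` (two `subRep`s of `constMul` copies) has integrand
`D_g(Q)(x)/√g(x)` ON the domain (pointwise; where `g ≤ 0` both sides are the same junk), so
`hExact Q s` makes it a relation, and `N•[r] − a•[b₀] − b•[b₁] ≡ [s]` by two rule-1b moves and
integer scaling. No hypothesis on `u`, `v` or the sign of `g` is used. [folklore] -/
theorem stub_reduction (g : ℚ[X]) (hg : g.natDegree = 3) (u v : ℝ)
    (hExact : ∀ (Q : ℚ[X]) (s : KZ.IntegralRep 1), s.domain = {p | u < p 0 ∧ p 0 < v} →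
      EqOn s.integrand (fun p => (aeval (p 0) (derivative Q) * aeval (p 0) g
        + aeval (p 0) Q * aeval (p 0) (derivative g) / 2) / Real.sqrt (aeval (p 0) g)) s.domain →
      KZ.of s ∈ KZ.relations)
    (b₀ b₁ r : KZ.IntegralRep 1) (m : ℕ)
    (hb₀ : b₀.domain = {p | u < p 0 ∧ p 0 < v})
    (hb₀i : EqOn b₀.integrand (fun p => 1 / Real.sqrt (aeval (p 0) g)) b₀.domain)
    (hb₁ : b₁.domain = {p | u < p 0 ∧ p 0 < v})
    (hb₁i : EqOn b₁.integrand (fun p => p 0 / Real.sqrt (aeval (p 0) g)) b₁.domain)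
    (hr : r.domain = {p | u < p 0 ∧ p 0 < v})
    (hri : EqOn r.integrand (fun p => p 0 ^ m / Real.sqrt (aeval (p 0) g)) r.domain) :
    ∃ (N : ℕ) (a b : ℤ), 0 < N ∧ N • KZ.of r - (a • KZ.of b₀ + b • KZ.of b₁) ∈ KZ.relations := by
  obtain ⟨N, a, b, Q, hN, hpoly⟩ := hermite_integer_normal_form g hg m
  -- the real form of Hermite's identity
  have hreal : ∀ x : ℝ, (N : ℝ) * x ^ m - a - b * x =
      aeval x (derivative Q) * aeval x g + aeval x Q * aeval x (derivative g) / 2 := by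
    intro x
    have h := congrArg (aeval x) hpoly
    simp only [map_mul, map_add, map_pow, aeval_X, aeval_C, eq_ratCast, Rat.cast_natCast,
      Rat.cast_intCast] at h
    push_cast at h
    linear_combination h
  -- the three scaled copies and the combination `s = N·r − a·b₀ − b·b₁`
  set rN := r.constMul (N : ℝ) (isAlgebraic_nat N) with hrN
  set bA := b₀.constMul (a : ℝ) (isAlgebraic_int a) with hbA
  set bB := b₁.constMul (b : ℝ) (isAlgebraic_int b) with hbB
  have hdA : bA.domain = rN.domain := by
    simp only [hbA, hrN, KZ.IntegralRep.domain_constMul, hb₀, hr]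
  set t := subRep rN bA hdA with ht
  have hdB : bB.domain = t.domain := by
    simp only [hbB, ht, subRep_domain, hrN, KZ.IntegralRep.domain_constMul, hb₁, hr]
  set s := subRep t bB hdB with hs
  have hs_dom : s.domain = {p | u < p 0 ∧ p 0 < v} := by
    simp only [hs, ht, subRep_domain, hrN, KZ.IntegralRep.domain_constMul, hr]
  have hs_int : EqOn s.integrand (fun p => (aeval (p 0) (derivative Q) * aeval (p 0) g
      + aeval (p 0) Q * aeval (p 0) (derivative g) / 2) / Real.sqrt (aeval (p 0) g)) s.domain := by
    intro p hp
    rw [hs_dom] at hp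
    have hpr : p ∈ r.domain := by rw [hr]; exact hp
    have hp0 : p ∈ b₀.domain := by rw [hb₀]; exact hp
    have hp1 : p ∈ b₁.domain := by rw [hb₁]; exact hp
    simp only [hs, ht, subRep_integrand, hrN, hbA, hbB, KZ.IntegralRep.integrand_constMul,
      Pi.sub_apply]
    rw [hri hpr, hb₀i hp0, hb₁i hp1, ← hreal (p 0)]
    ring
  have hs_rel : KZ.of s ∈ KZ.relations := hExact Q s hs_dom hs_int
  -- bookkeeping: `N•[r] − a•[b₀] − b•[b₁] ≡ [rN] − [bA] − [bB] ≡ [s] ≡ 0`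
  have h1 := of_sub_of_subRep_sub_of_mem_relations rN bA hdA
  have h2 := of_sub_of_subRep_sub_of_mem_relations t bB hdB
  have h3 := r.of_constMul_nat_sub_nsmul_mem_relations N
  have h4 := of_constMul_int_sub_zsmul_mem_relations b₀ a
  have h5 := of_constMul_int_sub_zsmul_mem_relations b₁ b
  refine ⟨N, a, b, hN, ?_⟩
  have e : N • KZ.of r - (a • KZ.of b₀ + b • KZ.of b₁) =
      (KZ.of rN - KZ.of t - KZ.of bA) + (KZ.of t - KZ.of s - KZ.of bB) + KZ.of s
        - (KZ.of rN - N • KZ.of r) + (KZ.of bA - a • KZ.of b₀) + (KZ.of bB - b • KZ.of b₁) := by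
    abel
  rw [e]
  exact add_mem (add_mem (sub_mem (add_mem (add_mem h1 h2) hs_rel) h3) h4) h5

end Summit.KontsevichZagierPeriods.HermiteRigidity.RealEllipticSectorKernel.DrefuteG3

end
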